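import Literature.Analysis.FluidPDE.OnsagerBDSVDeformationBoundsProofs
import HarnessLib

/-!
# The BDSV perturbation: the material derivative of the deformation (Prop. 5.9, (5.37)) — proof

Buckmaster–De Lellis–Székelyhidi–Vicol (BDSV), *Onsager's conjecture for admissible weak
solutions*, CPAM 72 (2019) = arXiv:1701.08678, Prop. 5.9, first item (arXiv (5.37)): for
`t ∈ Ĩ_i` and `N ≥ 0`, `‖D_{t,q} ∇Φ_i‖_N ≲ δ_q^{1/2} λ_q ℓ^{-N}`, `D_{t,q} = ∂ₜ + v̄_q·∇`. The printed
proof: "Observe that `D_{t,q}∇Φ_i = -∇Φ_i Dv̄_q`. In particular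
`‖D_{t,q}∇Φ_i‖_N ≲ ‖∇Φ_i‖₀‖v̄_q‖_{N+1} + ‖∇Φ_i‖_N‖v̄_q‖₁`. Thus (5.37) follows from (2.19) and
(5.23)." This file PROVES the named fact `BDSV.gradPhiTransportBound`
(`OnsagerBDSVDeformationBounds.lean`) along these lines, on top of the proof of (5.23)
(`OnsagerBDSVDeformationBoundsProofs.lean`):

* `BDSV.exists_threshold_displacement_le` — (5.23) in displacement form, at all levels with one
  threshold: for `a ≥ a₀(β, b, α, C_in, N)`, `‖D_i(t)‖_{n+1,0} ≤ ℓ^{-n}` for `n ≤ N ≤ N̄`, `t ∈ Ĩ_i`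
  (the all-orders flow bound `BDSV.displacement_allOrders` on the interval
  `[max(0,t_i - τ_q/3), min(T, t_{i+1} + τ_q/3)] ⊇ Ĩ_i` of length `≤ 5τ_q/3` around the anchor,
  fed with (2.19) and the smallness `(5/3) K |C_in| ℓ^{2α} ≤ 1`, as in `BDSV.gradPhiBound_holds`);
* `BDSV.PerturbationData.advectiveDeriv_gradPhi` — the identity `D_{t,q}∇Φ_i = -∇Φ_i Dv̄_q` on
  `[0,T] × T³`, `(Dv̄_q)_{cb} = ∂_b (v̄_q)_c`, from the tree's `BDSV.advectiveDeriv_gradField_eq`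
  (`(∂ₜ + v·∇)∇D = -∇v - ∇D∘∇v`), entrywise as in `BDSV.advectiveDeriv_det_jacobian`;
* `BDSV.gradPhiTransportBound_holds` — (5.37): the `C^{N,0}` norm of the matrix field `∇Φ_i Dv̄_q` is
  bounded entrywise by the Leibniz estimate for products of real functions
  (`BDSV.eContDiffHolderNorm_mul_le_sum`), with `‖(∇Φ_i)_{ac}‖_{j} ≤ 1 + ‖D_i‖_{j+1} ≤ 2ℓ^{-j}` and
  `‖∂_b(v̄_q)_c‖_{m} ≤ ‖v̄_q‖_{m+1} ≤ |C_in| δ_q^{1/2} λ_q ℓ^{-m}` ((2.19)); constants `α₀ = 1`,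
  `N̄ = N`, `C = 54 (N+1) 3ᴺ |C_in|`.

## References

* T. Buckmaster, C. De Lellis, L. Székelyhidi Jr., V. Vicol, *Onsager's conjecture for admissible
  weak solutions*, Comm. Pure Appl. Math. 72 (2019) 229–274 = arXiv:1701.08678, §5.5 Prop. 5.9
  (arXiv (5.37)) and its proof; Prop. 5.7 (arXiv (5.23)); §2.5 (2.19); App. A (A.3), App. B (B.6).
-/

open MeasureTheory Set
open scoped NNReal ENNReal ContDiff Matrix Matrix.Norms.Elementwise

noncomputable section

namespace Literature.Analysis.FluidPDE

namespace BDSV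

open FunctionSpaces FunctionSpaces.Torus

/-! ## (5.23), displacement form, at all levels with one threshold -/

section Displacement

/-- **The backward-flow displacements on `Ĩ_i` (BDSV Prop. 5.7, arXiv (5.23), displacement
form).** For `0 ≤ β`, `1 ≤ b`, `0 < α`, a constant `C_in` and a number of levels `N` there is
`a₀ > 1` such that for `a ≥ a₀`, every setting satisfying the standing hypotheses with
`N̄ ≥ N`, any construction data, any `i` and `t ∈ Ĩ_i`: `‖D_i(t)‖_{n+1,0} ≤ ℓ_q^{-n}` for all
`n ≤ N` (`Φ_i = id + D_i`; in particular `‖∇Φ_i - Id‖_n ≤ ℓ^{-n}`). Proof as in the source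
("`‖∇Φ_i‖_N ≲ 1 + τ_q‖Dv̄_q‖_N ≲ 1 + τ_q δ_q^{1/2} λ_q ℓ^{-N}`" by (2.19) and (B.6) on
`|t - t_i| ≲ τ_q`): `BDSV.displacement_allOrders` on `[max(0,t_i-τ_q/3), min(T,t_{i+1}+τ_q/3)]`
with `Λ = |C_in| δ_q^{1/2} λ_q`, `M = ℓ^{-1}`, and `(5/3) K |C_in| ℓ^{2α} ≤ 1` for `a ≥ a₀`
(`τ_q δ_q^{1/2} λ_q = ℓ^{2α}`). [cite: BuckmasterEtAl2018, Prop. 5.7 (arXiv (5.23)), proof] -/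
theorem exists_threshold_displacement_le {β b α : ℝ} (hβ : 0 ≤ β) (hb : 1 ≤ b) (hα : 0 < α)
    (Cin : ℝ) (N : ℕ) :
    ∃ a₀ : ℝ, 1 < a₀ ∧ ∀ {a : ℝ}, a₀ ≤ a →
      ∀ {S : Setting} {Nbar : ℕ} {C₀ c₀ : ℝ} {Cη : ℕ → ℕ → ℝ},
      PerturbationHypotheses ⟨β, α, a, b⟩ S Nbar Cin C₀ → N ≤ Nbar →
      ∀ (𝒟 : PerturbationData ⟨β, α, a, b⟩ S c₀ Cη) (i : ℕ),
      ∀ t ∈ tildeInterval S.T (Params.τ ⟨β, α, a, b⟩ S.q) i, ∀ n ≤ N,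
        Torus.eContDiffHolderNorm (n + 1) 0 (𝒟.D i t) ≤
          ENNReal.ofReal ((mollScale β α a b S.q)⁻¹ ^ n) := by
  obtain ⟨K, hK2, hK⟩ := displacement_allOrders (d := Fin 3) N
  have hK0 : 0 ≤ K := zero_le_two.trans hK2
  obtain ⟨a₀, ha₀1, ha₀⟩ :=
    exists_threshold_mollScale_rpow_le hβ hb hα (5 / 3 * K * |Cin|) one_pos
  refine ⟨a₀, ha₀1, ?_⟩
  intro a ha S Nbar C₀ c₀ Cη H hN 𝒟 i t ht n hn
  have ha1 : 1 ≤ a := ha₀1.le.trans ha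
  have hℓ : 0 < mollScale β α a b S.q := mollScale_pos ha1 _
  have hℓ1 : mollScale β α a b S.q ≤ 1 := mollScale_le_one_of_params ha1 hb hβ hα.le S.q
  have hτ : 0 < Params.τ ⟨β, α, a, b⟩ S.q := glueScale_pos ha1 _
  have hT : 0 < S.T := H.pos_T
  set ℓ := mollScale β α a b S.q with hℓdef
  set τ := Params.τ ⟨β, α, a, b⟩ S.q with hτdef
  set M := ℓ⁻¹ with hMdef
  have hM1 : 1 ≤ M := (one_le_inv₀ hℓ).2 hℓ1
  have hMk : ∀ k : ℕ, 1 ≤ M ^ k := fun k => one_le_pow₀ hM1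
  have hMpow : ∀ n : ℕ, ℓ ^ (-(n : ℝ)) = M ^ n := fun n => by
    rw [Real.rpow_neg hℓ.le, Real.rpow_natCast, hMdef, inv_pow]
  set Λ := |Cin| * (Real.sqrt (amp β a b S.q) * freq a b S.q) with hΛdef
  have hX0 : 0 ≤ Real.sqrt (amp β a b S.q) * freq a b S.q :=
    mul_nonneg (Real.sqrt_nonneg _) (freq_pos ha1 _).le
  have hΛ0 : 0 ≤ Λ := mul_nonneg (abs_nonneg _) hX0
  -- `Λ τ_q = |C_in| ℓ^{2α}` and the smallness for `a ≥ a₀`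
  have hΛτ : Λ * τ = |Cin| * ℓ ^ (2 * α) :=
    velocityBound_mul_tau (P := ⟨β, α, a, b⟩) (Cin := |Cin|) ha1 S.q
  have hsmall0 : 5 / 3 * K * |Cin| * ℓ ^ (2 * α) ≤ 1 := ha₀ a ha S.q
  -- (2.19) in the form `‖v̄_q(s)‖_{j+1} ≤ Λ M^j`, `j ≤ N`
  have hvb : ∀ s ∈ Icc 0 S.T, ∀ j ≤ N,
      Torus.eContDiffHolderNorm (j + 1) 0 (S.vbar s) ≤ ENNReal.ofReal (Λ * M ^ j) := by
    intro s hs j hj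
    refine (H.velocity j (hj.trans hN) s hs).trans (ENNReal.ofReal_le_ofReal ?_)
    change Cin * (Real.sqrt (amp β a b S.q) * freq a b S.q * ℓ ^ (-(j : ℝ))) ≤ Λ * M ^ j
    rw [hMpow j, hΛdef]
    calc Cin * (Real.sqrt (amp β a b S.q) * freq a b S.q * M ^ j)
        ≤ |Cin| * (Real.sqrt (amp β a b S.q) * freq a b S.q * M ^ j) :=
          mul_le_mul_of_nonneg_right (le_abs_self Cin) (mul_nonneg hX0 (zero_le_one.trans (hMk j)))
      _ = _ := by ring
  -- the transport equation of `D_i` on `[0,T]`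
  have heq0 : ∀ s ∈ Icc 0 S.T, ∀ x, timeDerivWithin (Icc 0 S.T) (𝒟.D i) s x +
      convect (S.vbar s) (𝒟.D i s) x = -S.vbar s x :=
    fun s hs x => eq_neg_of_add_eq_zero_left ((𝒟.flow i).transport s hs x)
  have hDsm : IsSmoothSpaceTimeOn (Icc 0 S.T) (𝒟.D i) := (𝒟.flow i).smooth
  have hvsm : IsSmoothSpaceTimeOn (Icc 0 S.T) S.vbar := H.eulerReynolds.smooth_velocity
  -- the interval `[a', b'] ⊇ Ĩ_i`
  obtain ⟨ht0, ht1⟩ := ht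
  set a' := max 0 ((i : ℝ) * τ - τ / 3) with ha'def
  set b' := min S.T (((i : ℝ) + 1) * τ + τ / 3) with hb'def
  have hi0 : 0 ≤ (i : ℝ) * τ := mul_nonneg i.cast_nonneg hτ.le
  have hab' : a' < b' := by
    refine max_lt (lt_min hT (by linarith [ht1.2, ht0.1])) (lt_min (by linarith [ht1.1, ht0.2]) ?_)
    nlinarith
  have hsub : Icc a' b' ⊆ Icc 0 S.T := fun s hs =>
    ⟨(le_max_left _ _).trans hs.1, hs.2.trans (min_le_left _ _)⟩
  have ht' : t ∈ Icc a' b' := ⟨max_le ht0.1 ht1.1.le, le_min ht0.2 ht1.2.le⟩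
  have ht₀ : min ((i : ℝ) * τ) S.T ∈ Icc a' b' := by
    refine ⟨max_le (le_min hi0 hT.le) (le_min (by linarith) (by linarith [ht1.1, ht0.2])),
      le_min (min_le_right _ _) ((min_le_left _ _).trans (by nlinarith))⟩
  have hlen : b' - a' ≤ 5 / 3 * τ := by
    have h1 : b' ≤ ((i : ℝ) + 1) * τ + τ / 3 := min_le_right _ _
    have h2 : (i : ℝ) * τ - τ / 3 ≤ a' := le_max_right _ _
    nlinarith
  -- smallness on `[a', b']`
  have hsmall : (b' - a') * Λ * K ≤ 1 := by
    calc (b' - a') * Λ * K ≤ (5 / 3 * τ) * Λ * K :=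
          mul_le_mul_of_nonneg_right (mul_le_mul_of_nonneg_right hlen hΛ0) hK0
      _ = 5 / 3 * K * (Λ * τ) := by ring
      _ = 5 / 3 * K * |Cin| * ℓ ^ (2 * α) := by rw [hΛτ]; ring
      _ ≤ 1 := hsmall0
  have hKLΛ : K * ((b' - a') * Λ) ≤ 1 := by
    calc K * ((b' - a') * Λ) = (b' - a') * Λ * K := by ring
      _ ≤ 1 := hsmall
  -- the all-orders bound for `D_i` on `[a', b']`
  have heq' := transport_restrict hab' hsub hDsm heq0
  have h := hK hab' (hvsm.mono hsub) (hDsm.mono hsub) heq' ht₀ (𝒟.flow i).anchor hΛ0 hM1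
    (fun s hs j hj => hvb s (hsub hs) j hj) hsmall t ht' n hn
  refine h.trans (ENNReal.ofReal_le_ofReal ?_)
  calc K * ((b' - a') * Λ) * M ^ n ≤ 1 * M ^ n :=
        mul_le_mul_of_nonneg_right hKLΛ (zero_le_one.trans (hMk n))
    _ = M ^ n := one_mul _

end Displacement

/-! ## The identity `D_{t,q}∇Φ_i = -∇Φ_i Dv̄_q` -/

section Identity

variable {P : Params} {S : Setting} {Nbar : ℕ} {Cin C₀ c₀ : ℝ} {Cη : ℕ → ℕ → ℝ}

/-- **`D_{t,q}∇Φ_i = -∇Φ_i Dv̄_q`** (BDSV, proof of Prop. 5.9, first display): for the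
construction data of the perturbation step under the standing hypotheses, the material
derivative `∂ₜ + v̄_q·∇` (one-sided in time within `[0,T]`) of the deformation matrix
`∇Φ_i = Id + ∇D_i` (`BDSV.gradPhi`) of the `i`-th backward flow equals `-∇Φ_i · Dv̄_q` on
`[0,T] × T³`, where `(Dv̄_q)_{cb} = ∂_b (v̄_q)_c`. (Differentiate the transport equation
`(∂ₜ + v̄·∇)Φ_i = 0` in space: the tree's `BDSV.advectiveDeriv_gradField_eq`, read entrywise.)
[cite: BuckmasterEtAl2018, Prop. 5.9 (proof, first display)] -/
theorem PerturbationData.advectiveDeriv_gradPhi (H : PerturbationHypotheses P S Nbar Cin C₀)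
    (𝒟 : PerturbationData P S c₀ Cη) (i : ℕ) {t : ℝ} (ht : t ∈ Icc 0 S.T) (x : UnitAddTorus (Fin 3)) :
    advectiveDeriv S.T S.vbar (fun s y => gradPhi 𝒟.D i s y) t x =
      -(gradPhi 𝒟.D i t x * Matrix.of fun c b => partialDeriv b (S.vbar t) x c) := by
  have hT := H.pos_T
  have hv := H.eulerReynolds.smooth_velocity
  have hD : IsSmoothSpaceTimeOn (Icc 0 S.T) (𝒟.D i) := (𝒟.flow i).smooth
  have hGfield := hD.gradField (uniqueDiffOn_Icc hT)
  -- the entries `E` of `∇D_i`, `Jf` of `Id + ∇D_i`, and the velocity gradient `W`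
  set E : ℝ → UnitAddTorus (Fin 3) → (Fin 3 → Fin 3 → ℝ) := fun s y a b =>
    (gradField (𝒟.D i) s y (EuclideanSpace.single b 1)) a with hE
  set Jf : ℝ → UnitAddTorus (Fin 3) → (Fin 3 → Fin 3 → ℝ) := fun s y a b =>
    (if a = b then (1 : ℝ) else 0) + (gradField (𝒟.D i) s y (EuclideanSpace.single b 1)) a with hJf
  set W : Matrix (Fin 3) (Fin 3) ℝ :=
    Matrix.of fun a b => (gradField S.vbar t x (EuclideanSpace.single b 1)) a with hW
  have hJsm : IsSmoothSpaceTimeOn (Icc 0 S.T) Jf := isSmoothSpaceTimeOn_jacobianEntries hT hD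
  have hofJ : ∀ s y, Matrix.of (Jf s y) = (1 : Matrix (Fin 3) (Fin 3) ℝ) + Matrix.of (E s y) :=
    fun s y => of_jacobianEntries s y
  -- (1) `∇Φ_i = of Jf` on `[0,T]`, and `W` through partial derivatives
  have h1 : ∀ s ∈ Icc 0 S.T, ∀ y, gradPhi 𝒟.D i s y = Matrix.of (Jf s y) := by
    intro s hs y
    have hc : IsContDiff 1 (𝒟.D i s) := (hD.isSmooth_slice hs).isContDiff (by simp)
    ext a b
    simp only [gradPhi, Matrix.add_apply, Matrix.one_apply, Matrix.of_apply, hJf, gradField_apply,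
      partialDeriv_eq_fderiv_apply hc]
  have hWeq : W = Matrix.of fun c b => partialDeriv b (S.vbar t) x c := by
    have hc : IsContDiff 1 (S.vbar t) := (hv.isSmooth_slice ht).isContDiff (by simp)
    ext c b
    simp only [hW, Matrix.of_apply, gradField_apply, partialDeriv_eq_fderiv_apply hc]
  -- (2) replace the field inside the material derivative (only its values on `[0,T]` matter)
  have h2 : advectiveDeriv S.T S.vbar (fun s y => gradPhi 𝒟.D i s y) t x =
      advectiveDeriv S.T S.vbar (fun s y => Matrix.of (Jf s y)) t x := by
    rw [advectiveDeriv_apply, advectiveDeriv_apply]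
    have e : (fun y => gradPhi 𝒟.D i t y) = fun y => Matrix.of (Jf t y) := funext (h1 t ht)
    congr 1
    · unfold timeDerivWithin
      exact derivWithin_congr (fun s hs => h1 s hs x) (h1 t ht x)
    · show Torus.fderiv (fun y => gradPhi 𝒟.D i t y) x (S.vbar t x) =
        Torus.fderiv (fun y => Matrix.of (Jf t y)) x (S.vbar t x)
      rw [e]
  -- (3) the matrix-valued field and the field of its entries have the same material derivative
  have h3 : advectiveDeriv S.T S.vbar (fun s y => Matrix.of (Jf s y)) t x =
      Matrix.of (advectiveDeriv S.T S.vbar Jf t x) := rfl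
  -- (4) entrywise: `(∂ₜ + v̄·∇)(Id + ∇D_i) = -(Id + ∇D_i) W`
  have hadv := advectiveDeriv_gradField_eq hT hv hD (fun s hs y => (𝒟.flow i).advectiveDeriv_eq hs y)
    ht x
  have h4 : Matrix.of (advectiveDeriv S.T S.vbar Jf t x) = -(Matrix.of (Jf t x) * W) := by
    rw [hofJ, Matrix.add_mul, Matrix.one_mul]
    ext a b
    set L : (EuclideanSpace ℝ (Fin 3) →L[ℝ] EuclideanSpace ℝ (Fin 3)) →L[ℝ] ℝ :=
      (EuclideanSpace.proj a).comp
        (ContinuousLinearMap.apply ℝ (EuclideanSpace ℝ (Fin 3)) (EuclideanSpace.single b 1)) with hL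
    have hLapp : ∀ φ : EuclideanSpace ℝ (Fin 3) →L[ℝ] EuclideanSpace ℝ (Fin 3),
        L φ = (φ (EuclideanSpace.single b 1)) a := fun φ => rfl
    have e1 : advectiveDeriv S.T S.vbar Jf t x a b =
        advectiveDeriv S.T S.vbar (fun s y => Jf s y a b) t x := by
      have h := advectiveDeriv_clm_apply (v := S.vbar) hT hJsm (matrixEntry a b) ht x
      simpa only [matrixEntry_apply] using h.symm
    have e2 : (fun s y => Jf s y a b) =
        fun s y => (if a = b then (1 : ℝ) else 0) + L (gradField (𝒟.D i) s y) := by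
      funext s y
      simp only [hJf, hLapp]
    rw [Matrix.of_apply, e1, e2, advectiveDeriv_const_add,
      advectiveDeriv_clm_apply (v := S.vbar) hT hGfield L ht x, hadv, hLapp, Matrix.neg_apply,
      Matrix.add_apply, Matrix.mul_apply]
    change -(gradField S.vbar t x (EuclideanSpace.single b 1)) a -
        (gradField (𝒟.D i) t x (gradField S.vbar t x (EuclideanSpace.single b 1))) a = _
    rw [gradField_apply_coord (D := 𝒟.D i) t x (gradField S.vbar t x (EuclideanSpace.single b 1)) a]
    simp only [hE, hW, Matrix.of_apply, Fin.sum_univ_three]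
    ring
  rw [h2, h3, h4, ← h1 t ht x, hWeq]

end Identity

/-! ## Prop. 5.9, (5.37) -/

section Main

variable {d : Type} [Fintype d]

/-- Products of two real functions with level-wise bounds `‖f‖_{j,r} ≤ E_j`, `‖g‖_{j,r} ≤ F_j`
(`j ≤ N`): `‖fg‖_{N,r} ≤ 3ᴺ ∑_{j ≤ N} E_j F_{N-j}` (the Leibniz estimate
`BDSV.eContDiffHolderNorm_mul_le_sum`). [folklore] -/
theorem eContDiffHolderNorm_mul_le_of_levels₂ {N : ℕ} {f g : UnitAddTorus d → ℝ}
    (hf : IsContDiff N f) (hg : IsContDiff N g) (r : ℝ≥0) {E F : ℕ → ℝ} (hE0 : ∀ j, 0 ≤ E j)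
    (hF0 : ∀ j, 0 ≤ F j) (hfE : ∀ j ≤ N, Torus.eContDiffHolderNorm j r f ≤ ENNReal.ofReal (E j))
    (hgF : ∀ j ≤ N, Torus.eContDiffHolderNorm j r g ≤ ENNReal.ofReal (F j)) :
    Torus.eContDiffHolderNorm N r (fun x => f x * g x) ≤
      ENNReal.ofReal (3 ^ N * ∑ j ∈ Finset.range (N + 1), E j * F (N - j)) := by
  refine (eContDiffHolderNorm_mul_le_sum hf hg r).trans ?_
  rw [ENNReal.ofReal_mul (by positivity), ENNReal.ofReal_pow (by norm_num), ENNReal.ofReal_ofNat,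
    ENNReal.ofReal_sum_of_nonneg fun j _ => mul_nonneg (hE0 _) (hF0 _)]
  refine mul_le_mul' le_rfl (Finset.sum_le_sum fun j hj => ?_)
  have hjN : j ≤ N := Nat.lt_succ_iff.1 (Finset.mem_range.1 hj)
  rw [ENNReal.ofReal_mul (hE0 _)]
  exact mul_le_mul' (hfE j hjN) (hgF (N - j) (Nat.sub_le N j))

/-- `∑_{k : Fin 3} ofReal q = ofReal (3q)` in `ℝ≥0∞`. [folklore] -/
theorem sum_fin_three_ofReal_const (q : ℝ) :
    ∑ _k : Fin 3, ENNReal.ofReal q = ENNReal.ofReal (3 * q) := by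
  rw [Finset.sum_const, Finset.card_univ, Fintype.card_fin, nsmul_eq_mul, Nat.cast_ofNat,
    ENNReal.ofReal_mul (by norm_num), ENNReal.ofReal_ofNat]

/-- **BDSV Prop. 5.9, first item (arXiv (5.37)): `‖D_{t,q}∇Φ_i‖_N ≲ δ_q^{1/2} λ_q ℓ^{-N}` on
`Ĩ_i`** — the named fact `BDSV.gradPhiTransportBound` holds. Proof as printed:
`D_{t,q}∇Φ_i = -∇Φ_i Dv̄_q` (`BDSV.PerturbationData.advectiveDeriv_gradPhi`); the `C^{N,0}` norm
of the matrix field is bounded through its entries `∑_c (∇Φ_i)_{ac} ∂_b(v̄_q)_c` by the Leibniz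
estimate, with `‖(∇Φ_i)_{ac}‖_j ≤ 1 + ‖D_i‖_{j+1} ≤ 2ℓ^{-j}` ((5.23) in displacement form,
`BDSV.exists_threshold_displacement_le`) and `‖∂_b(v̄_q)_c‖_m ≤ ‖v̄_q‖_{m+1} ≤ |C_in| δ_q^{1/2}λ_q ℓ^{-m}`
((2.19)); constants `α₀ = 1`, `N̄ = N`, `C = 54 (N+1) 3ᴺ |C_in|`, `a₀ = a₀(β, b, α, C_in, N)`.
[cite: BuckmasterEtAl2018, Prop. 5.9 (arXiv (5.37))] -/
theorem gradPhiTransportBound_holds : gradPhiTransportBound := by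
  intro c₀ _ Cη β hβ _ b hb1 _
  refine ⟨1, one_pos, ?_⟩
  intro α hα _ N
  refine ⟨N, ?_⟩
  intro Cin C₀
  obtain ⟨a₀, ha₀1, hdisp⟩ := exists_threshold_displacement_le hβ.le hb1.le hα Cin N
  refine ⟨54 * ((N : ℝ) + 1) * 3 ^ N * |Cin|, a₀, ha₀1, ?_⟩
  intro a ha S H 𝒟 i t ht
  -- parameters
  have ha1 : 1 ≤ a := ha₀1.le.trans ha
  have hℓ : 0 < mollScale β α a b S.q := mollScale_pos ha1 _
  have hℓ1 : mollScale β α a b S.q ≤ 1 := mollScale_le_one_of_params ha1 hb1.le hβ.le hα.le S.q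
  set ℓ := mollScale β α a b S.q with hℓdef
  set M := ℓ⁻¹ with hMdef
  have hM1 : 1 ≤ M := (one_le_inv₀ hℓ).2 hℓ1
  have hM0 : 0 ≤ M := zero_le_one.trans hM1
  have hMk : ∀ k : ℕ, 1 ≤ M ^ k := fun k => one_le_pow₀ hM1
  have hMpow : ∀ n : ℕ, ℓ ^ (-(n : ℝ)) = M ^ n := fun n => by
    rw [Real.rpow_neg hℓ.le, Real.rpow_natCast, hMdef, inv_pow]
  set Λ := |Cin| * (Real.sqrt (amp β a b S.q) * freq a b S.q) with hΛdef
  have hX0 : 0 ≤ Real.sqrt (amp β a b S.q) * freq a b S.q :=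
    mul_nonneg (Real.sqrt_nonneg _) (freq_pos ha1 _).le
  have hΛ0 : 0 ≤ Λ := mul_nonneg (abs_nonneg _) hX0
  have ht' : t ∈ Icc 0 S.T := tildeInterval_subset_Icc _ _ _ ht
  have hDt : IsSmooth (𝒟.D i t) := (𝒟.flow i).smooth.isSmooth_slice ht'
  have hvs : IsSmooth (S.vbar t) := H.eulerReynolds.smooth_velocity.isSmooth_slice ht'
  -- (5.23), displacement form, and (2.19)
  have hDb : ∀ n ≤ N, Torus.eContDiffHolderNorm (n + 1) 0 (𝒟.D i t) ≤ ENNReal.ofReal (M ^ n) :=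
    fun n hn => hdisp ha H le_rfl 𝒟 i t ht n hn
  -- level-wise bounds for the entries of `∇Φ_i(t)` and of `Dv̄_q(t)`
  have hAe : ∀ k₁ k₃ : Fin 3, IsContDiff N (fun x => gradPhi 𝒟.D i t x k₁ k₃) := fun k₁ k₃ =>
    (isSmooth_gradPhi_entry hDt k₁ k₃).isContDiff (by exact_mod_cast le_top)
  have hBe : ∀ k₃ k₂ : Fin 3, IsContDiff N (fun x => partialDeriv k₂ (S.vbar t) x k₃) :=
    fun k₃ k₂ => ((hvs.partialDeriv k₂).apply k₃).isContDiff (by exact_mod_cast le_top)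
  have hAE : ∀ j ≤ N, ∀ k₁ k₃ : Fin 3,
      Torus.eContDiffHolderNorm j 0 (fun x => gradPhi 𝒟.D i t x k₁ k₃) ≤ ENNReal.ofReal (2 * M ^ j) := by
    intro j hj k₁ k₃
    have e : (fun x => gradPhi 𝒟.D i t x k₁ k₃) =
        fun x => (1 : Matrix (Fin 3) (Fin 3) ℝ) k₁ k₃ + partialDeriv k₃ (𝒟.D i t) x k₁ := by
      funext x; exact gradPhi_apply 𝒟.D i t x k₁ k₃
    rw [e]
    refine (eContDiffHolderNorm_const_add_partialDeriv_le hDt _ k₁ k₃ j 0).trans ?_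
    have h1 : ‖(1 : Matrix (Fin 3) (Fin 3) ℝ) k₁ k₃‖ₑ ≤ ENNReal.ofReal (M ^ j) := by
      rw [← ofReal_norm]
      refine ENNReal.ofReal_le_ofReal (le_trans ?_ (hMk j))
      rw [Matrix.one_apply]
      split_ifs <;> simp
    calc ‖(1 : Matrix (Fin 3) (Fin 3) ℝ) k₁ k₃‖ₑ + Torus.eContDiffHolderNorm (j + 1) 0 (𝒟.D i t)
        ≤ ENNReal.ofReal (M ^ j) + ENNReal.ofReal (M ^ j) := add_le_add h1 (hDb j hj)
      _ = ENNReal.ofReal (2 * M ^ j) := by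
          rw [two_mul, ENNReal.ofReal_add (by positivity) (by positivity)]
  have hBF : ∀ j ≤ N, ∀ k₃ k₂ : Fin 3,
      Torus.eContDiffHolderNorm j 0 (fun x => partialDeriv k₂ (S.vbar t) x k₃) ≤
        ENNReal.ofReal (Λ * M ^ j) := by
    intro j hj k₃ k₂
    have hpd : IsSmooth (partialDeriv k₂ (S.vbar t)) := hvs.partialDeriv k₂
    refine ((eContDiffHolderNorm_coord_le hpd j 0 k₃).trans
      (Torus.eContDiffHolderNorm_partialDeriv_le (hvs.isContDiff (by exact_mod_cast le_top)) k₂ 0)).trans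
      ?_
    refine (H.velocity j hj t ht').trans (ENNReal.ofReal_le_ofReal ?_)
    change Cin * (Real.sqrt (amp β a b S.q) * freq a b S.q * ℓ ^ (-(j : ℝ))) ≤ Λ * M ^ j
    rw [hMpow j, hΛdef]
    calc Cin * (Real.sqrt (amp β a b S.q) * freq a b S.q * M ^ j)
        ≤ |Cin| * (Real.sqrt (amp β a b S.q) * freq a b S.q * M ^ j) :=
          mul_le_mul_of_nonneg_right (le_abs_self Cin) (mul_nonneg hX0 (zero_le_one.trans (hMk j)))
      _ = _ := by ring
  -- the products `(∇Φ_i)_{ac} ∂_b(v̄_q)_c`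
  set q : ℝ := 3 ^ N * (((N : ℝ) + 1) * (2 * Λ * M ^ N)) with hqdef
  have hq0 : 0 ≤ q := by positivity
  have hprod : ∀ k₁ k₂ k₃ : Fin 3, Torus.eContDiffHolderNorm N 0
      (fun x => gradPhi 𝒟.D i t x k₁ k₃ * partialDeriv k₂ (S.vbar t) x k₃) ≤ ENNReal.ofReal q := by
    intro k₁ k₂ k₃
    refine (eContDiffHolderNorm_mul_le_of_levels₂ (hAe k₁ k₃) (hBe k₃ k₂) 0
      (E := fun j => 2 * M ^ j) (F := fun j => Λ * M ^ j) (fun j => by positivity)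
      (fun j => by positivity) (fun j hj => hAE j hj k₁ k₃) (fun j hj => hBF j hj k₃ k₂)).trans
      (ENNReal.ofReal_le_ofReal (le_of_eq ?_))
    have hterm : ∀ j ∈ Finset.range (N + 1), 2 * M ^ j * (Λ * M ^ (N - j)) = 2 * Λ * M ^ N := by
      intro j hj
      have hjN : j ≤ N := Nat.lt_succ_iff.1 (Finset.mem_range.1 hj)
      have hpow : M ^ j * M ^ (N - j) = M ^ N := by rw [← pow_add, Nat.add_sub_cancel' hjN]
      calc 2 * M ^ j * (Λ * M ^ (N - j)) = 2 * Λ * (M ^ j * M ^ (N - j)) := by ring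
        _ = 2 * Λ * M ^ N := by rw [hpow]
    rw [Finset.sum_congr rfl hterm, Finset.sum_const, Finset.card_range, nsmul_eq_mul, hqdef]
    push_cast
    ring
  -- the entries of `∇Φ_i Dv̄_q`
  set Wm : UnitAddTorus (Fin 3) → Matrix (Fin 3) (Fin 3) ℝ :=
    fun x => Matrix.of fun c b' => partialDeriv b' (S.vbar t) x c with hWm
  have hent : ∀ k₁ k₂ : Fin 3,
      Torus.eContDiffHolderNorm N 0 (fun x => (gradPhi 𝒟.D i t x * Wm x) k₁ k₂) ≤
        ENNReal.ofReal (3 * q) := by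
    intro k₁ k₂
    have e : (fun x => (gradPhi 𝒟.D i t x * Wm x) k₁ k₂) =
        ∑ k₃, fun x => gradPhi 𝒟.D i t x k₁ k₃ * partialDeriv k₂ (S.vbar t) x k₃ := by
      funext x
      simp only [Finset.sum_apply, Matrix.mul_apply, hWm, Matrix.of_apply]
    rw [e, ← sum_fin_three_ofReal_const q]
    refine (Torus.eContDiffHolderNorm_sum_le Finset.univ fun k₃ _ => ?_).trans
      (Finset.sum_le_sum fun k₃ _ => hprod k₁ k₂ k₃)
    exact (hAe k₁ k₃).mul (hBe k₃ k₂)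
  -- the matrix field `∇Φ_i Dv̄_q` is `C^N`
  have hAB : IsContDiff N (fun x => gradPhi 𝒟.D i t x * Wm x) := by
    refine contDiff_pi.2 fun k₁ => contDiff_pi.2 fun k₂ => ?_
    have e : (fun y => lift (fun x => gradPhi 𝒟.D i t x * Wm x) y k₁ k₂) =
        fun y => ∑ k₃, lift (fun x => gradPhi 𝒟.D i t x k₁ k₃) y *
          lift (fun x => partialDeriv k₂ (S.vbar t) x k₃) y := by
      funext y
      simp only [lift_apply, Matrix.mul_apply, hWm, Matrix.of_apply]
    rw [e]
    exact ContDiff.sum fun k₃ _ => (hAe k₁ k₃).mul (hBe k₃ k₂)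
  -- assemble
  have hslice : advectiveDeriv S.T S.vbar (fun s y => gradPhi 𝒟.D i s y) t =
      -(fun x => gradPhi 𝒟.D i t x * Wm x) :=
    funext fun x => 𝒟.advectiveDeriv_gradPhi H i ht' x
  show Torus.eContDiffHolderNorm N 0 (advectiveDeriv S.T S.vbar (fun s y => gradPhi 𝒟.D i s y) t) ≤
    ENNReal.ofReal (54 * ((N : ℝ) + 1) * 3 ^ N * |Cin| *
      (Real.sqrt (amp β a b S.q) * freq a b S.q * ℓ ^ (-(N : ℝ))))
  rw [hslice, Torus.eContDiffHolderNorm_neg]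
  refine (eContDiffHolderNorm_matrix_le_sum hAB 0).trans ?_
  calc ∑ k₁, ∑ k₂, Torus.eContDiffHolderNorm N 0 (fun x => (gradPhi 𝒟.D i t x * Wm x) k₁ k₂)
      ≤ ∑ _k₁ : Fin 3, ∑ _k₂ : Fin 3, ENNReal.ofReal (3 * q) :=
        Finset.sum_le_sum fun k₁ _ => Finset.sum_le_sum fun k₂ _ => hent k₁ k₂
    _ = ENNReal.ofReal (3 * (3 * (3 * q))) := by
        rw [sum_fin_three_ofReal_const, sum_fin_three_ofReal_const]
    _ = ENNReal.ofReal (54 * ((N : ℝ) + 1) * 3 ^ N * |Cin| *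
          (Real.sqrt (amp β a b S.q) * freq a b S.q * ℓ ^ (-(N : ℝ)))) := by
        rw [hMpow N, hqdef, hΛdef]
        ring_nf

end Main

end BDSV

end Literature.Analysis.FluidPDE
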